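import Mathlib.Topology.UniformSpace.Dini
import Summits.Ventures.PercRepro0.ContAbove
import Summits.Ventures.PercRepro0.TwoPoint

/-!
# PM-B · UNIFORM-TRUNCATED on the cell's definitions (seat p3)

Kernel-checked twin of route/TMID-PLAN-plan-2-v1.md §3.2 (block M; an equivalent form of the
residual, not progress on its truth). With the truncated two-point function
`τ^f_p(0,x) := P_p(0 ↔ x, 0 ↮ ∞)` (`tauF`) and the uniform decay statement
`UniformTruncatedDecay d : ∀ ε > 0, ∃ N, ∀ p ∈ [0,1], ∀ x with ‖x‖_∞ ≥ N, τ^f_p(0,x) < ε`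
(the ε–N form of `lim_n sup_p sup_{‖x‖ ≥ n} τ^f_p(0,x) = 0`):

`T_iff_uniformTruncatedDecay : T d ↔ UniformTruncatedDecay d` for `d ≥ 1` with `p_c(d) < 1`, given
P3 · UNIQUE in dimension `d`.

Proof (the plan's sketch, line by line). (⇐) If `θ := θ_d(p_c) > 0`: for `q < p_c`, `θ_d(q) = 0` (L0) so
`τ^f_q = τ_q`; by F4(ii) (`continuousWithinAt_tau_Iio`) `τ_{p_c}(0,x) = lim_{q↑p_c} τ_q(0,x) ≤ θ²/2` if the
uniform decay held with `ε = θ²/2`, contradicting H4 `τ_{p_c}(0,x) ≥ θ²` (`HighDClose.thetaI_sq_le_tau_of_P3`).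
(⇒) Given `T d` and `ε > 0`: by L2 (right-continuity at `p_c`) pick `p₁ ∈ (p_c, 1]` with `θ_d(p₁) < ε/2`.
For `p ≤ p₁` and `‖x‖ ≥ n`: `τ^f_p(0,x) ≤ θ_n(p) ≤ θ_n(p₁)` (Lemma 2.1 + L1) `→ θ_d(p₁) < ε/2` (L2(i)), so
`< ε` for `n ≥ n₀`. For `p ∈ [p₁, 1]`: `τ^f_p(0,x) ≤ θ_n(p) − θ_d(p)` (`{0 ↔ x, 0 ↮ ∞} ⊆ A_n ∖ {0 ↔ ∞}`);
`θ_n` is continuous (`continuous_theta_box`), `θ_d` is continuous on `[p₁, 1]` (PM-A + L2,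
`ContAbove.continuousAt_theta_of_pc_lt`), `θ_n ↓ θ_d` pointwise (L2(i)), so Dini's theorem
(`Antitone.tendstoUniformlyOn_of_forall_tendsto`) gives `θ_n − θ_d < ε` uniformly on `[p₁, 1]` for
`n ≥ n₁`. Take `N = max n₀ n₁`.

Inputs: L0, L1, L2, F4(ii), H4 (P3, P7, F1, F2), PM-A, Lemma 2.1, Dini — all kernel-checked except the
hypothesis `P3_Unique d`. Nothing here decides `T d` for any `3 ≤ d ≤ 10`.
-/

namespace Summit.Ventures.PercRepro0.TruncDecay

open MeasureTheory ProbabilityTheory unitInterval Set Filter Topology Defs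
open scoped ENNReal

variable {d : ℕ}

/-- The truncated two-point function `τ^f_p(0,x) = P_p(0 ↔ x, 0 ↮ ∞)`. -/
noncomputable def tauF (d : ℕ) (p : I) (x : Vertex d) : ℝ :=
  (P d p ({ω | Conn d ω 0 x} \ percolates d)).toReal

/-- PM-B's decay statement, ε–N form: `sup_{p ∈ [0,1]} sup_{‖x‖_∞ ≥ n} τ^f_p(0,x) → 0`. -/
def UniformTruncatedDecay (d : ℕ) : Prop :=
  ∀ ε : ℝ, 0 < ε → ∃ N : ℕ, ∀ (p : I) (x : Vertex d), N ≤ PcChi.nrm x → tauF d p x < ε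

/-- `θ_n(r) := P_r(0 ↔ ∂Λ_n)` as a real function of the (clamped) real parameter. -/
noncomputable def thetaBox (d n : ℕ) (r : ℝ) : ℝ := (P d (clamp r) (toBoundary d n)).toReal

/-- `0 ≤ τ^f_p(0,x)`. -/
theorem tauF_nonneg (p : I) (x : Vertex d) : 0 ≤ tauF d p x := ENNReal.toReal_nonneg

/-- `clamp` restricted to `[0,1]` is the identity (real value). -/
theorem coe_clamp_of_mem' {r : ℝ} (hr : r ∈ Icc (0 : ℝ) 1) : ((clamp r : I) : ℝ) = r := by
  unfold clamp
  rw [Set.projIcc_of_mem _ hr]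

/-- Below `p_c` the truncation is void: `τ^f_q(0,x) = τ_q(0,x)` when `θ_d(q) = 0`. -/
theorem tauF_eq_tau_of_thetaI_eq_zero {q : I} (hq : thetaI d q = 0) (x : Vertex d) :
    tauF d q x = tau d q 0 x := by
  unfold tauF tau
  congr 1
  have h0 : P d q (percolates d) = 0 := by
    unfold thetaI at hq
    exact ((ENNReal.toReal_eq_zero_iff _).1 hq).resolve_right (measure_ne_top _ _)
  exact measure_sdiff_null h0

/-- Lemma 2.1 for the truncated function: for `n ≤ ‖x‖_∞`, `τ^f_p(0,x) ≤ θ_n(p) − θ_d(p)`. -/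
theorem tauF_le_sub (hd : 1 ≤ d) (p : I) {n : ℕ} {x : Vertex d} (hn : n ≤ PcChi.nrm x) :
    tauF d p x ≤ (P d p (toBoundary d n)).toReal - thetaI d p := by
  have hsub : {ω : Config d | Conn d ω 0 x} \ percolates d ⊆ toBoundary d n \ percolates d :=
    sdiff_subset_sdiff_left ((PcChi.conn_subset_toBoundary hd x).trans (toBoundary_antitone hn))
  have hpe : percolates d ⊆ toBoundary d n := by
    rw [percolates_eq_iInter_toBoundary]
    exact iInter_subset _ n
  have hdiff : P d p (toBoundary d n \ percolates d) =
      P d p (toBoundary d n) - P d p (percolates d) :=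
    measure_sdiff hpe measurableSet_percolates.nullMeasurableSet (measure_ne_top _ _)
  unfold tauF thetaI
  calc (P d p ({ω | Conn d ω 0 x} \ percolates d)).toReal
      ≤ (P d p (toBoundary d n \ percolates d)).toReal :=
        ENNReal.toReal_mono (measure_ne_top _ _) (measure_mono hsub)
    _ = (P d p (toBoundary d n)).toReal - (P d p (percolates d)).toReal := by
        rw [hdiff, ENNReal.toReal_sub_of_le (measure_mono hpe) (measure_ne_top _ _)]

/-- `θ_n` is non-increasing in `n` (pointwise). -/
theorem thetaBox_antitone (r : ℝ) : Antitone fun n => thetaBox d n r := fun _ _ hmn =>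
  ENNReal.toReal_mono (measure_ne_top _ _) (measure_mono (toBoundary_antitone hmn))

/-- PM-B (⇒): `T d` gives the uniform decay of the truncated two-point function (`d ≥ 1`,
`p_c(d) < 1`, P3 in dimension `d`). -/
theorem uniformTruncatedDecay_of_T (hd : 1 ≤ d) (hpc : pc d < 1) (hP3 : P3_Unique d) (hT : T d) :
    UniformTruncatedDecay d := by
  intro ε hε
  -- Step 1: `p₁ ∈ (p_c, 1]` with `θ_d(p₁) < ε/2` (right-continuity at `p_c`, `θ_d(p_c) = 0`)
  have hT' : theta d (pc d) = 0 := hT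
  obtain ⟨δ, hδ, hδ'⟩ := Metric.continuousWithinAt_iff.1
    (continuousWithinAt_theta_Ioi (d := d) (pc d)) (ε / 2) (by linarith)
  set p₁ : ℝ := min (pc d + δ / 2) 1 with hp₁
  have hp₁_gt : pc d < p₁ := lt_min (by linarith) hpc
  have hp₁_le : p₁ ≤ 1 := min_le_right _ _
  have hp₁_le' : p₁ ≤ pc d + δ / 2 := min_le_left _ _
  have hp₁_mem : p₁ ∈ Icc (0 : ℝ) 1 := ⟨(pc_nonneg (d := d)).trans hp₁_gt.le, hp₁_le⟩
  have hθ₁ : theta d p₁ < ε / 2 := by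
    have hdist : dist p₁ (pc d) < δ := by
      rw [Real.dist_eq, abs_lt]
      constructor <;> linarith
    have := hδ' (mem_Ioi.2 hp₁_gt) hdist
    rwa [Real.dist_eq, hT', sub_zero, abs_of_nonneg (theta_nonneg d p₁)] at this
  -- Step 2: `n₀` with `θ_n(p₁) < ε/2` for `n ≥ n₀` (L2(i))
  have hlim₁ : Tendsto (fun n => thetaBox d n p₁) atTop (𝓝 (theta d p₁)) :=
    tendsto_P_toBoundary (clamp p₁)
  obtain ⟨n₀, hn₀⟩ := (hlim₁.eventually (gt_mem_nhds hθ₁)).exists_forall_of_atTop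
  -- Step 3: Dini on `[p₁, 1]`: `θ_n → θ_d` uniformly
  have hDini : TendstoUniformlyOn (fun n r => thetaBox d n r) (theta d) atTop (Icc p₁ 1) := by
    refine Antitone.tendstoUniformlyOn_of_forall_tendsto isCompact_Icc
      (fun n => (continuous_theta_box n).continuousOn) (fun r _ => thetaBox_antitone r) ?_ ?_
    · intro r hr
      exact (ContAbove.continuousAt_theta_of_pc_lt hd hP3 (hp₁_gt.trans_le hr.1)
        hr.2).continuousWithinAt
    · intro r _
      exact tendsto_P_toBoundary (clamp r)
  obtain ⟨n₁, hn₁⟩ := (Metric.tendstoUniformlyOn_iff.1 hDini ε hε).exists_forall_of_atTop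
  refine ⟨max n₀ n₁, fun p x hx => ?_⟩
  have key := tauF_le_sub hd p hx
  by_cases hp : (p : ℝ) ≤ p₁
  · -- `τ^f_p ≤ θ_N(p) ≤ θ_N(p₁) < ε/2`
    have hle : p ≤ clamp p₁ := by
      apply Subtype.coe_le_coe.1
      rw [coe_clamp_of_mem' hp₁_mem]
      exact hp
    have h1 : (P d p (toBoundary d (max n₀ n₁))).toReal ≤ thetaBox d (max n₀ n₁) p₁ :=
      ENNReal.toReal_mono (measure_ne_top _ _) (L1_Monotone_holds d p (clamp p₁) hle _
        (isUpperSet_toBoundary _) (measurableSet_toBoundary _))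
    have h2 := hn₀ _ (le_max_left n₀ n₁)
    linarith [thetaI_nonneg d p]
  · -- `p ∈ [p₁, 1]`: Dini's uniform bound
    have hp' : p₁ < p := not_le.1 hp
    have hmem : (p : ℝ) ∈ Icc p₁ 1 := ⟨hp'.le, p.2.2⟩
    have h3 := hn₁ _ (le_max_right n₀ n₁) p hmem
    rw [Real.dist_eq, abs_lt] at h3
    have e1 : theta d (p : ℝ) = thetaI d p := by
      unfold theta
      rw [ContAbove.clamp_coe]
    have e2 : thetaBox d (max n₀ n₁) (p : ℝ) = (P d p (toBoundary d (max n₀ n₁))).toReal := by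
      unfold thetaBox
      rw [ContAbove.clamp_coe]
    linarith [h3.1]

/-- PM-B (⇐): the uniform decay forces `T d` (`d ≥ 1`, P3 in dimension `d`): otherwise H4 at `p_c`
and the left-continuity of `τ` (F4(ii)) contradict the decay below `p_c`. -/
theorem T_of_uniformTruncatedDecay (hd : 1 ≤ d) (hP3 : P3_Unique d)
    (h : UniformTruncatedDecay d) : T d := by
  by_contra hne
  have hθ : 0 < thetaI d (clamp (pc d)) := lt_of_le_of_ne (thetaI_nonneg _ _) (Ne.symm hne)
  obtain ⟨N, hN⟩ := h (thetaI d (clamp (pc d)) ^ 2 / 2) (by positivity)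
  -- a point at distance `N`
  set x : Vertex d := fun _ => (N : ℤ) with hx
  have hxN : N ≤ PcChi.nrm x := by
    have := PcChi.natAbs_le_nrm x ⟨0, hd⟩
    simpa [hx] using this
  have hH4 : thetaI d (clamp (pc d)) ^ 2 ≤ tau d (clamp (pc d)) 0 x :=
    HighD.thetaI_sq_le_tau_of_P3 d _ x hP3
  have hpos := ContAbove.pc_pos hd
  have hle : tau d (clamp (pc d)) 0 x ≤ thetaI d (clamp (pc d)) ^ 2 / 2 := by
    refine le_of_tendsto (continuousWithinAt_tau_Iio (d := d) 0 x (pc d)) ?_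
    filter_upwards [self_mem_nhdsWithin, mem_nhdsWithin_of_mem_nhds (Ici_mem_nhds hpos)]
      with r hr hr0
    have hθr : thetaI d (clamp r) = 0 := theta_eq_zero_of_lt_pc hd hr0 hr
    have := hN (clamp r) x hxN
    rw [tauF_eq_tau_of_thetaI_eq_zero hθr] at this
    exact this.le
  have hsq : 0 < thetaI d (clamp (pc d)) ^ 2 := by positivity
  linarith

/-- **PM-B · UNIFORM-TRUNCATED** (TMID-PLAN-plan-2-v1 §3.2): for `d ≥ 1` with `p_c(d) < 1` and P3 in
dimension `d`, `T d ⟺` the truncated two-point function decays uniformly in `p`. -/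
theorem T_iff_uniformTruncatedDecay (hd : 1 ≤ d) (hpc : pc d < 1) (hP3 : P3_Unique d) :
    T d ↔ UniformTruncatedDecay d :=
  ⟨uniformTruncatedDecay_of_T hd hpc hP3, T_of_uniformTruncatedDecay hd hP3⟩

end Summit.Ventures.PercRepro0.TruncDecay
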